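import Literature.NumberTheory.Automorphic.UnitaryGroupAdelicCenter
import Literature.NumberTheory.Automorphic.UnitaryGroupRestrictedProduct
import HarnessLib

/-!
# The finite-adelic centre `U(1)(𝔸_{F,f}) → U(J)(𝔸_{F,f})` and the anti-diagonal centre of a dual pair

Topic `NumberTheory/Automorphic`; namespace `Literature.NumberTheory.Automorphic.UnitaryGroup`.  Kernel only
(definitions and theorems; 0 records, 0 named facts).  The finite-adelic companion of
`UnitaryGroupAdelicCenter.lean`:

* `finAdelicOne F E c ≤ (𝔸_E^∞)ˣ` — the norm-one finite idèles `{u | (c ⊗ 1)(u) · u = 1}` = `U(1)(𝔸_{F,f})`, the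
  finite-adelic points of the centre `U_{E/F}(1)` of every `U_{E/F}(N)` ([Mok2014, §1 Notation p. 5]);
* `finAdelicCenter F E c N J : finAdelicOne F E c →* finAdelic F E c N J`, `u ↦ u · 1_N` (kernel:
  `scalar_mem_unitaryGroupOfForm` over `𝔸_E^∞`), central (`finAdelicCenter_mem_center`);
* `finCenterAdelic`, `coe_finCenterAdelic` — inside `U(J)(𝔸_F)` the element `(1, u · 1_N)` is the scalar matrix of the
  idèle `(1, u)`;
* **`adelicInl_finAdelicCenter_eq_adelicInr_finAdelicCenter`** — in the big unitary group `G₁(𝔸_F) = U(J_V ⊗ J_W)(𝔸_F)`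
  of a dual pair, `(1, u · 1_V) ⊗ 1 = 1 ⊗ (1, u · 1_W)`: the two centres have the SAME image (the finite-adelic form of
  `adelicInl_adelicCenter_mul_adelicInr_adelicCenter_inv`), so every homomorphism on `G₁(𝔸_F)` — in particular a
  compatible splitting into the metaplectic group — takes the same value on them;
* `finAdelicCenter_surjective_one` — for `N = 1` and `J 0 0 ≠ 0`, `U(J)(𝔸_{F,f})` IS the norm-one torus: every element
  is `u · 1_1`, `u ∈ finAdelicOne`.

## References
* [Mok2014] C. P. Mok, *Endoscopic classification of representations of quasi-split unitary groups*, Mem. AMS 235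
  (2015), §1 Notation p. 5 (centre of `U_{E/F}(N)` = `U_{E/F}(1)`).
* [GelbartRogawski1991] S. Gelbart, J. Rogawski, Invent. Math. 105 (1991), §3.1 p. 454 (the dual pair
  `U(V) × U(W) → Sp(Res_{E/F}(V ⊗ W))`).
-/

noncomputable section

open scoped Matrix Kronecker

open NumberField IsDedekindDomain

namespace Literature.NumberTheory.Automorphic

namespace UnitaryGroup

section FinCenter

variable (F E : Type) [Field F] [NumberField F] [Field E] [NumberField E] [Algebra F E] (c : E ≃ₐ[F] E)

omit [NumberField F] in
/-- **`U(1)(𝔸_{F,f})`, the norm-one finite idèles of `E/F`**: `{u ∈ (𝔸_E^∞)ˣ | (c ⊗ 1)(u) · u = 1}`.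
[cite: Mok2014, §1 Notation p. 5] -/
def finAdelicOne : Subgroup (FiniteAdeleRing (𝓞 E) E)ˣ where
  carrier := {u | conjFiniteAdele F E c (u : FiniteAdeleRing (𝓞 E) E) * u = 1}
  one_mem' := by
    show conjFiniteAdele F E c ((1 : (FiniteAdeleRing (𝓞 E) E)ˣ) : FiniteAdeleRing (𝓞 E) E) * _ = 1
    rw [Units.val_one, map_one, one_mul]
  mul_mem' {u v} hu hv := by
    have hu' : conjFiniteAdele F E c (u : FiniteAdeleRing (𝓞 E) E) * u = 1 := hu
    have hv' : conjFiniteAdele F E c (v : FiniteAdeleRing (𝓞 E) E) * v = 1 := hv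
    show conjFiniteAdele F E c ((u * v : (FiniteAdeleRing (𝓞 E) E)ˣ) : FiniteAdeleRing (𝓞 E) E) * _ = 1
    rw [Units.val_mul, map_mul, mul_mul_mul_comm, hu', hv', one_mul]
  inv_mem' {u} hu := by
    have hu' : conjFiniteAdele F E c (u : FiniteAdeleRing (𝓞 E) E) * u = 1 := hu
    show conjFiniteAdele F E c ((u⁻¹ : (FiniteAdeleRing (𝓞 E) E)ˣ) : FiniteAdeleRing (𝓞 E) E) * _ = 1
    have h : conjFiniteAdele F E c ((u⁻¹ : (FiniteAdeleRing (𝓞 E) E)ˣ) : FiniteAdeleRing (𝓞 E) E) *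
        ((u⁻¹ : (FiniteAdeleRing (𝓞 E) E)ˣ) : FiniteAdeleRing (𝓞 E) E) *
          (conjFiniteAdele F E c (u : FiniteAdeleRing (𝓞 E) E) * u) = 1 := by
      rw [mul_mul_mul_comm, ← map_mul, Units.inv_mul, map_one, one_mul]
    rwa [hu', mul_one] at h

omit [NumberField F] in
/-- Membership in `finAdelicOne` (definitional). [cite: Mok2014, §1 Notation p. 5] -/
theorem mem_finAdelicOne_iff (u : (FiniteAdeleRing (𝓞 E) E)ˣ) :
    u ∈ finAdelicOne F E c ↔ conjFiniteAdele F E c (u : FiniteAdeleRing (𝓞 E) E) * u = 1 :=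
  Iff.rfl

variable (N : ℕ) (J : Matrix (Fin N) (Fin N) E)

omit [NumberField F] in
/-- **The finite-adelic centre `U(1)(𝔸_{F,f}) → U(J)(𝔸_{F,f})`, `u ↦ u · 1_N`.** [cite: Mok2014, §1 Notation p. 5] -/
def finAdelicCenter : finAdelicOne F E c →* finAdelic F E c N J :=
  MonoidHom.codRestrict
    ((Units.map (Matrix.scalar (Fin N) :
          FiniteAdeleRing (𝓞 E) E →+* Matrix (Fin N) (Fin N) (FiniteAdeleRing (𝓞 E) E)).toMonoidHom).comp
      (finAdelicOne F E c).subtype)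
    (finAdelic F E c N J) fun u => scalar_mem_unitaryGroupOfForm _ _ _ u.2

omit [NumberField F] in
/-- underlying matrix of the central element: the scalar matrix `u · 1_N`. [cite: Mok2014, §1 Notation p. 5] -/
@[simp] theorem coe_finAdelicCenter (u : finAdelicOne F E c) :
    (((finAdelicCenter F E c N J u : finAdelic F E c N J) : GL (Fin N) (FiniteAdeleRing (𝓞 E) E)) :
        Matrix (Fin N) (Fin N) (FiniteAdeleRing (𝓞 E) E)) =
      ((u : (FiniteAdeleRing (𝓞 E) E)ˣ) : FiniteAdeleRing (𝓞 E) E) • (1 : Matrix (Fin N) (Fin N) (FiniteAdeleRing (𝓞 E) E)) :=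
  (Matrix.smul_one_eq_diagonal _).symm

omit [NumberField F] in
/-- `u · 1_N` is central in `U(J)(𝔸_{F,f})`. [cite: Mok2014, §1 Notation p. 5] -/
theorem finAdelicCenter_mem_center (u : finAdelicOne F E c) :
    finAdelicCenter F E c N J u ∈ Subgroup.center (finAdelic F E c N J) := by
  rw [Subgroup.mem_center_iff]
  intro g
  apply Subtype.ext
  apply Units.ext
  simp only [Subgroup.coe_mul, Units.val_mul, coe_finAdelicCenter, Matrix.mul_smul, Matrix.smul_mul, Matrix.mul_one,
    Matrix.one_mul]

omit [NumberField F] in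
/-- `(u · 1_N) · g = g · (u · 1_N)`. [cite: Mok2014, §1 Notation p. 5] -/
theorem finAdelicCenter_mul_comm (u : finAdelicOne F E c) (g : finAdelic F E c N J) :
    finAdelicCenter F E c N J u * g = g * finAdelicCenter F E c N J u :=
  (Subgroup.mem_center_iff.1 (finAdelicCenter_mem_center F E c N J u) g).symm

/-- **the idèle with trivial archimedean component**, `u ↦ (1, u) : (𝔸_E^∞)ˣ → 𝔸_Eˣ` (on the ring level
`x ↦ (1, x)`, multiplicative). [folklore] -/
def finIdeleHom : FiniteAdeleRing (𝓞 E) E →* AdeleRing (𝓞 E) E where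
  toFun x := ((1 : InfiniteAdeleRing E), x)
  map_one' := rfl
  map_mul' _ _ := Prod.ext (mul_one _).symm rfl

/-- components of `finIdeleHom x`: `(1, x)`. [cite: Mok2014, §1 Notation p. 5] -/
@[simp] theorem finIdeleHom_apply (x : FiniteAdeleRing (𝓞 E) E) :
    finIdeleHom E x = ((1 : InfiniteAdeleRing E), x) := rfl

/-- **the finite-adelic centre seen in `U(J)(𝔸_F)`**: `u ↦ (1, u · 1_N)`, i.e. `finAdelicToAdelic ∘ finAdelicCenter`,
with codomain the adelic points `UnitaryGroup.adelic F E c N J`. [cite: Mok2014, §1 Notation p. 5] -/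
def finCenterAdelic : finAdelicOne F E c →* adelic F E c N J :=
  (finAdelicToAdelic F E c N J).comp (finAdelicCenter F E c N J)

/-- unfolding. [cite: Mok2014, §1 Notation p. 5] -/
theorem finCenterAdelic_apply (u : finAdelicOne F E c) :
    finCenterAdelic F E c N J u = finAdelicToAdelic F E c N J (finAdelicCenter F E c N J u) := rfl

/-- **Inside `U(J)(𝔸_F)`**: the matrix of `(1, u · 1_N)` is the scalar matrix of the idèle `(1, u) ∈ 𝔸_E = E_∞ × 𝔸_E^∞`.
[cite: Mok2014, §1 Notation p. 5] -/
theorem coe_finCenterAdelic (u : finAdelicOne F E c) :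
    (((finCenterAdelic F E c N J u : adelic F E c N J) : GL (Fin N) (AdeleRing (𝓞 E) E)) :
        Matrix (Fin N) (Fin N) (AdeleRing (𝓞 E) E)) =
      finIdeleHom E ((u : (FiniteAdeleRing (𝓞 E) E)ˣ) : FiniteAdeleRing (𝓞 E) E) •
        (1 : Matrix (Fin N) (Fin N) (AdeleRing (𝓞 E) E)) := by
  change ((GLn.ofFinite N E ((finAdelicCenter F E c N J u : finAdelic F E c N J) :
      GL (Fin N) (FiniteAdeleRing (𝓞 E) E)) : GL (Fin N) (AdeleRing (𝓞 E) E)) :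
      Matrix (Fin N) (Fin N) (AdeleRing (𝓞 E) E)) = _
  ext i j
  rw [GLn.coe_ofFinite_apply, coe_finAdelicCenter, Matrix.smul_apply, Matrix.smul_apply, Matrix.one_apply,
    Matrix.one_apply, Matrix.one_apply]
  by_cases h : i = j
  · simp only [h, if_true, smul_eq_mul, mul_one]
    rfl
  · simp only [h, if_false, smul_zero]
    rfl

end FinCenter

/-! ### The anti-diagonal centre of a dual pair, finite-adelic form -/

section AntiDiagonal

variable (F E : Type) [Field F] [NumberField F] [Field E] [NumberField E] [Algebra F E] (c : E ≃ₐ[F] E)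
variable (N M : ℕ) (JV : Matrix (Fin N) (Fin N) E) (JW : Matrix (Fin M) (Fin M) E)

/-- **`(1, u · 1_V) ⊗ 1 = 1 ⊗ (1, u · 1_W)` in `G₁(𝔸_F) = U(J_V ⊗ J_W)(𝔸_F)`**: the finite-adelic centres of the two
members of the dual pair have the same image in the big unitary group, so every homomorphism on `G₁(𝔸_F)` agrees on
them. [cite: GelbartRogawski1991, §3.1 p. 454] -/
theorem adelicInl_finAdelicCenter_eq_adelicInr_finAdelicCenter (u : finAdelicOne F E c) :
    adelicInl F E c N M JV JW (finCenterAdelic F E c N JV u) =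
      adelicInr F E c N M JV JW (finCenterAdelic F E c M JW u) := by
  apply Subtype.ext
  apply Units.ext
  rw [coe_adelicInl, coe_adelicInr, coe_finCenterAdelic, coe_finCenterAdelic, Matrix.smul_kronecker,
    Matrix.kronecker_smul, Matrix.one_kronecker_one]

/-- product form: `(1, u · 1_V) ⊗ 1 · 1 ⊗ (1, u⁻¹ · 1_W) = 1`. [cite: GelbartRogawski1991, §3.1 p. 454] -/
theorem adelicInl_finAdelicCenter_mul_adelicInr_finAdelicCenter_inv (u : finAdelicOne F E c) :
    adelicInl F E c N M JV JW (finCenterAdelic F E c N JV u) *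
        adelicInr F E c N M JV JW (finCenterAdelic F E c M JW u⁻¹) = 1 := by
  rw [adelicInl_finAdelicCenter_eq_adelicInr_finAdelicCenter, ← map_mul, ← map_mul, mul_inv_cancel, map_one, map_one]

/-- the same anti-diagonal relation with `finAdelicToAdelic ∘ finAdelicCenter` spelled out (the syntactic form met
when unfolding pair splittings). [cite: Mok2014, §1 Notation p. 5] -/
theorem adelicInl_finAdelicToAdelic_finAdelicCenter_mul_inv (u : finAdelicOne F E c) :
    adelicInl F E c N M JV JW (finAdelicToAdelic F E c N JV (finAdelicCenter F E c N JV u)) *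
        adelicInr F E c N M JV JW (finAdelicToAdelic F E c M JW (finAdelicCenter F E c M JW u⁻¹)) = 1 :=
  adelicInl_finAdelicCenter_mul_adelicInr_finAdelicCenter_inv F E c N M JV JW u

end AntiDiagonal

/-! ### `N = 1`: the unitary group of a line IS the norm-one torus -/

section One

variable (F E : Type) [Field F] [NumberField F] [Field E] [NumberField E] [Algebra F E] (c : E ≃ₐ[F] E)
variable (J : Matrix (Fin 1) (Fin 1) E)

omit [NumberField F] in
/-- for `J = (j)` with `j ≠ 0`: every `g ∈ U(J)(𝔸_{F,f})` is the scalar `g₀₀ · 1_1` of a norm-one finite idèle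
(`c(g₀₀) j g₀₀ = j` and `j` is a unit of `𝔸_E^∞`). [cite: Mok2014, §1 Notation p. 5] -/
theorem finAdelicCenter_surjective_one (hJ : J 0 0 ≠ 0) : Function.Surjective (finAdelicCenter F E c 1 J) := by
  intro g
  -- the entry `g₀₀` as a unit, with inverse `(g⁻¹)₀₀`
  have hmul : ∀ a b : GL (Fin 1) (FiniteAdeleRing (𝓞 E) E),
      ((a * b : GL (Fin 1) (FiniteAdeleRing (𝓞 E) E)) : Matrix (Fin 1) (Fin 1) (FiniteAdeleRing (𝓞 E) E)) 0 0 =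
        (a : Matrix (Fin 1) (Fin 1) (FiniteAdeleRing (𝓞 E) E)) 0 0 * (b : Matrix (Fin 1) (Fin 1) _) 0 0 := by
    intro a b
    rw [Units.val_mul, Matrix.mul_apply, Fin.sum_univ_one]
  let z : (FiniteAdeleRing (𝓞 E) E)ˣ :=
    ⟨((g : GL (Fin 1) (FiniteAdeleRing (𝓞 E) E)) : Matrix (Fin 1) (Fin 1) _) 0 0,
      ((g⁻¹ : finAdelic F E c 1 J) : GL (Fin 1) (FiniteAdeleRing (𝓞 E) E)) 0 0,
      by rw [← hmul, Subgroup.coe_inv, mul_inv_cancel, Units.val_one, Matrix.one_apply_eq],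
      by rw [← hmul, Subgroup.coe_inv, inv_mul_cancel, Units.val_one, Matrix.one_apply_eq]⟩
  -- norm one: from `c(g)ᵀ J g = J` at the entry `(0,0)`, cancelling the unit `j`
  have hj : IsUnit (algebraMap E (FiniteAdeleRing (𝓞 E) E) (J 0 0)) := (IsUnit.mk0 _ hJ).map _
  have hz : z ∈ finAdelicOne F E c := by
    rw [mem_finAdelicOne_iff]
    have h := g.2
    rw [mem_finAdelic_iff] at h
    have h00 := congrArg (fun A : Matrix (Fin 1) (Fin 1) (FiniteAdeleRing (𝓞 E) E) => A 0 0) h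
    simp only [Matrix.mul_apply, Fin.sum_univ_one, Matrix.transpose_apply, Matrix.map_apply, finiteAdelicForm] at h00
    -- h00 : c(g₀₀) * j * g₀₀ = j
    have hzv : (z : FiniteAdeleRing (𝓞 E) E) =
        ((g : GL (Fin 1) (FiniteAdeleRing (𝓞 E) E)) : Matrix (Fin 1) (Fin 1) _) 0 0 := rfl
    have h' : algebraMap E (FiniteAdeleRing (𝓞 E) E) (J 0 0) *
        (conjFiniteAdele F E c (z : FiniteAdeleRing (𝓞 E) E) * z) =
        algebraMap E (FiniteAdeleRing (𝓞 E) E) (J 0 0) * 1 := by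
      rw [hzv, mul_one]
      calc algebraMap E (FiniteAdeleRing (𝓞 E) E) (J 0 0) *
            (conjFiniteAdele F E c (((g : GL (Fin 1) (FiniteAdeleRing (𝓞 E) E)) : Matrix (Fin 1) (Fin 1) _) 0 0) *
              ((g : GL (Fin 1) (FiniteAdeleRing (𝓞 E) E)) : Matrix (Fin 1) (Fin 1) _) 0 0)
          = conjFiniteAdele F E c (((g : GL (Fin 1) (FiniteAdeleRing (𝓞 E) E)) : Matrix (Fin 1) (Fin 1) _) 0 0) *
              algebraMap E (FiniteAdeleRing (𝓞 E) E) (J 0 0) *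
              ((g : GL (Fin 1) (FiniteAdeleRing (𝓞 E) E)) : Matrix (Fin 1) (Fin 1) _) 0 0 := by ring
        _ = algebraMap E (FiniteAdeleRing (𝓞 E) E) (J 0 0) := h00
    exact hj.mul_left_cancel h'
  refine ⟨⟨z, hz⟩, ?_⟩
  apply Subtype.ext
  apply Units.ext
  ext i j
  fin_cases i; fin_cases j
  rw [coe_finAdelicCenter, Matrix.smul_apply, Matrix.one_apply_eq, smul_eq_mul, mul_one]
  rfl

end One

end UnitaryGroup

end Literature.NumberTheory.Automorphic
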